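import Summits.NavierStokesRegularity.NavierStokesRegularity.Theses.SwirlThreshold
import Summits.NavierStokesRegularity.NavierStokesRegularity.Theorems.SwirlThresholdSwirlSupStrictDecreaseDecay
import Summits.NavierStokesRegularity.NavierStokesRegularity.Theorems.SwirlThresholdSwirlSupStrictDecreaseStrong
import Summits.NavierStokesRegularity.NavierStokesRegularity.Theorems.SwirlThresholdSwirlSupStrictDecreaseRegular
import Literature.Analysis.FluidPDE.NSViscosityRescaling
import HarnessLib

/-!
# `SwirlSupStrictDecrease` (route `SwirlThreshold`, support item stmt-NavierStokesRegularity-2004)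

The threshold structure of the swirl, sup-free form: along a classical solution `(u, p)` of the
unforced Navier–Stokes system (`ν > 0`) on `[0, T) × ℝ³` which is a Leray–Hopf (finite energy)
solution from a rapidly decaying axisymmetric datum `u(0)`, for `0 ≤ s < t < T` with
`Γ(s) ≢ 0` there is `y` with `|Γ(t, x)| < |Γ(s, y)|` for all `x` — the swirl supremum
`M(t) = sup_x |x₀u₁ − x₁u₀|` is strictly decreasing while the swirl is non-zero
(`SwirlSupStrictDecrease_proof`, closing
`Summit.NavierStokesRegularity.NavierStokesRegularity.Theses.SwirlThreshold.SwirlSupStrictDecrease`).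

## Proof

1. *Regularity* (`regular_of_classical_lerayHopf`, file `…Regular`): on `[0, t]` the solution is
   classical on the closed slab, the velocity is bounded by some `V` (energy inequality, Tao 2013
   Cor. 11.1 = `tao2011_hasBoundedSobolevNormsOn_holds`, `H² ⊂ C_B`) and every slice is
   axisymmetric (rotation covariance + Prodi–Serrin weak–strong uniqueness,
   `weak_strong_uniqueness_holds`).
2. *Decay* (`abs_swirl_mul_le_of_classical`, file `…Decay`): `|Γ(τ, x)|(1 + |x|²) ≤ D` on
   `[0, t] × ℝ³` (decaying barrier), so `M := sup |Γ(s, ·)| < ∞` and the supremum of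
   `|Γ(t, ·)|` is attained unless `Γ(t) ≡ 0` (`exists_forall_le_of_decay`).
3. *Weak maximum principle* from time `s` (`abs_swirl_le_of_classical`, Lei–Zhang 2017 (1.4)):
   `|Γ| ≤ M` on `[s, t] × ℝ³` (time translation `u(· + s)`).
4. *Strong maximum principle* (`abs_swirl_lt_of_classical`, file `…Strong`, KNSS 2009 Lemma 2.1
   = `KNSS2009_lemma21_holds`), after the viscosity rescaling `ν⁻¹u(s + ·/ν)` to unit viscosity
   (`IsClassicalNSSolutionOn.viscosityRescale_zero`): `|Γ(t, x)| < M` for every `x`.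
5. Hence `max_x |Γ(t, x)| < M = sup_y |Γ(s, y)|`, and a `y` with `|Γ(s, y)| > max_x |Γ(t, x)|`
   exists by the definition of the supremum.
-/

noncomputable section

-- the summit and its single problem share the name (D-0017 nested layout)
set_option linter.dupNamespace false

open Set Function Filter Topology MeasureTheory InnerProductSpace Metric WithLp
open scoped RealInnerProductSpace ContDiff NNReal ENNReal

namespace Summit.NavierStokesRegularity.NavierStokesRegularity.Theorems

namespace SwirlSupStrictDecrease

open Literature.Analysis.FluidPDE

/-! ### Three elementary lemmas -/

/-- The swirl is linear in the field: `Γ[c u] = c Γ[u]`. [folklore] -/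
theorem swirl_const_smul (c : ℝ) (f : (EuclideanSpace ℝ (Fin 3)) → (EuclideanSpace ℝ (Fin 3)))
    (x : EuclideanSpace ℝ (Fin 3)) : swirl (c • f) x = c * swirl f x := by
  simp only [swirl, Pi.smul_apply, PiLp.smul_apply, smul_eq_mul]
  ring

/-- Rotations about the axis are linear: `R_θ (c y) = c R_θ y`. [folklore] -/
theorem rotZ_const_smul (θ c : ℝ) (y : EuclideanSpace ℝ (Fin 3)) : rotZ θ (c • y) = c • rotZ θ y := by
  ext i
  fin_cases i <;> simp <;> ring

/-- Scalar multiples of axisymmetric fields are axisymmetric (rotations are linear). [folklore] -/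
theorem isAxisymmetric_const_smul (c : ℝ) {f : (EuclideanSpace ℝ (Fin 3)) → (EuclideanSpace ℝ (Fin 3))}
    (hf : IsAxisymmetric f) : IsAxisymmetric (c • f) := by
  intro θ x
  simp only [Pi.smul_apply]
  rw [hf θ x, rotZ_const_smul]

/-- **A nonnegative continuous function decaying at infinity attains its supremum** (unless it
vanishes identically): if `f(x)(1 + |x|²) ≤ D` and `f(x₁) > 0` somewhere, then `f` has a
maximum point (maximise over a large closed ball containing `x₁`, outside of which
`f ≤ D/(1 + R²) < f(x₁)`). [folklore] -/
theorem exists_forall_le_of_decay {f : (EuclideanSpace ℝ (Fin 3)) → ℝ} (hf : Continuous f)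
    {D : ℝ} (hD : ∀ x, f x * (1 + ‖x‖ ^ 2) ≤ D)
    {x₁ : EuclideanSpace ℝ (Fin 3)} (hx₁ : 0 < f x₁) : ∃ xs, ∀ x, f x ≤ f xs := by
  have hD0 : 0 ≤ D := by
    have h1 : 0 ≤ f x₁ * (1 + ‖x₁‖ ^ 2) := by positivity
    exact h1.trans (hD x₁)
  set R : ℝ := max ‖x₁‖ (Real.sqrt (D / f x₁)) with hR
  have hR0 : 0 ≤ R := le_trans (norm_nonneg _) (le_max_left _ _)
  have hx₁K : x₁ ∈ closedBall (0 : EuclideanSpace ℝ (Fin 3)) R :=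
    mem_closedBall_zero_iff.2 (le_max_left _ _)
  obtain ⟨xs, hxsK, hmax⟩ := (isCompact_closedBall (0 : EuclideanSpace ℝ (Fin 3)) R).exists_isMaxOn
    ⟨x₁, hx₁K⟩ hf.continuousOn
  refine ⟨xs, fun x => ?_⟩
  by_cases hx : x ∈ closedBall (0 : EuclideanSpace ℝ (Fin 3)) R
  · exact hmax hx
  · -- outside the ball: `f x ≤ D / (1 + |x|²) ≤ D / (1 + R²) < f x₁ ≤ f xs`
    have hxR : R < ‖x‖ := by simpa using hx
    have hpos : (0 : ℝ) < 1 + ‖x‖ ^ 2 := by positivity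
    have h1 : f x ≤ D / (1 + ‖x‖ ^ 2) := by rw [le_div_iff₀ hpos]; exact hD x
    have h2 : D / (1 + ‖x‖ ^ 2) ≤ D / (1 + R ^ 2) :=
      div_le_div_of_nonneg_left hD0 (by positivity) (by nlinarith)
    have h3 : D / (1 + R ^ 2) < f x₁ := by
      rw [div_lt_iff₀ (by positivity)]
      have hsq : D / f x₁ ≤ R ^ 2 := by
        have h4 : Real.sqrt (D / f x₁) ≤ R := le_max_right _ _
        have h5 : 0 ≤ Real.sqrt (D / f x₁) := Real.sqrt_nonneg _
        calc D / f x₁ = Real.sqrt (D / f x₁) ^ 2 := (Real.sq_sqrt (div_nonneg hD0 hx₁.le)).symm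
          _ ≤ R ^ 2 := pow_le_pow_left₀ h5 h4 2
      rw [div_le_iff₀ hx₁] at hsq
      nlinarith
    have h4 : f x₁ ≤ f xs := hmax hx₁K
    linarith

end SwirlSupStrictDecrease

open Literature.Analysis.FluidPDE SwirlSupStrictDecrease

/-- **`SwirlSupStrictDecrease` holds** (support item stmt-NavierStokesRegularity-2004 of route
`SwirlThreshold`): along a finite-energy (Leray–Hopf) classical solution of the unforced
Navier–Stokes system on `[0, T)` from a rapidly decaying axisymmetric datum, for
`0 ≤ s < t < T` with `Γ(s) ≢ 0` there is `y` with `|Γ(t, x)| < |Γ(s, y)|` for all `x`: the swirl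
supremum is strictly decreasing while the swirl is non-zero. See the module docstring for the
proof (bounded velocity and axisymmetry by Tao 2013 Cor. 11.1 and weak–strong uniqueness; decay of
the swirl by a barrier; weak and strong maximum principles for the swirl equation, Lei–Zhang 2017
(1.4) and KNSS 2009 Lemma 2.1). -/
theorem SwirlSupStrictDecrease_proof :
    Summit.NavierStokesRegularity.NavierStokesRegularity.Theses.SwirlThreshold.SwirlSupStrictDecrease := by
  unfold Summit.NavierStokesRegularity.NavierStokesRegularity.Theses.SwirlThreshold.SwirlSupStrictDecrease
  intro ν T hν hT u p hcl hLH hdec haxi s t hs hst htT hne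
  obtain ⟨y₀, hy₀⟩ := hne
  have ht0 : 0 < t := lt_of_le_of_lt hs hst
  -- Step 1: regularity on `[0, t]`
  obtain ⟨hclt, ⟨V, hV0, hV⟩, haxit⟩ := regular_of_classical_lerayHopf hν hcl hLH hdec haxi ht0 htT
  -- Step 2: decay of the swirl on `[0, t]`
  obtain ⟨C, hC⟩ := hdec 0 3
  have hM₀ : ∀ x, |swirl (u 0) x| * (1 + ‖x‖ ^ 2) ≤ 2 * C := by
    intro x
    have h1 := hC x
    rw [norm_iteratedFDeriv_zero] at h1
    have h2 : |swirl (u 0) x| ≤ 2 * ‖x‖ * ‖u 0 x‖ := abs_swirl_le_norm_mul (u 0) x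
    have h3 : ‖x‖ * (1 + ‖x‖ ^ 2) ≤ (1 + ‖x‖) ^ 3 := by nlinarith [norm_nonneg x, sq_nonneg ‖x‖]
    have h4 : 0 ≤ ‖u 0 x‖ := norm_nonneg _
    calc |swirl (u 0) x| * (1 + ‖x‖ ^ 2) ≤ 2 * ‖x‖ * ‖u 0 x‖ * (1 + ‖x‖ ^ 2) :=
          mul_le_mul_of_nonneg_right h2 (by positivity)
      _ = 2 * (‖x‖ * (1 + ‖x‖ ^ 2)) * ‖u 0 x‖ := by ring
      _ ≤ 2 * (1 + ‖x‖) ^ 3 * ‖u 0 x‖ := by gcongr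
      _ = 2 * ((1 + ‖x‖) ^ 3 * ‖u 0 x‖) := by ring
      _ ≤ 2 * C := by linarith
  have hC0 : 0 ≤ 2 * C := by
    have h1 : 0 ≤ |swirl (u 0) 0| * (1 + ‖(0 : EuclideanSpace ℝ (Fin 3))‖ ^ 2) := by positivity
    exact h1.trans (hM₀ 0)
  have hdecay := abs_swirl_mul_le_of_classical hν ht0 hclt haxit hV hM₀
  set D : ℝ := 2 * C * Real.exp ((6 * ν + V + 1) * t) with hDdef
  have hD : ∀ τ ∈ Icc 0 t, ∀ x, |swirl (u τ) x| * (1 + ‖x‖ ^ 2) ≤ D := by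
    intro τ hτ x
    refine (hdecay τ hτ x).trans ?_
    rw [hDdef]
    refine mul_le_mul_of_nonneg_left (Real.exp_le_exp.2 ?_) hC0
    exact mul_le_mul_of_nonneg_left hτ.2 (by positivity)
  have hD' : ∀ τ ∈ Icc 0 t, ∀ x, |swirl (u τ) x| ≤ D := fun τ hτ x =>
    le_trans (le_mul_of_one_le_right (abs_nonneg _) (by nlinarith [sq_nonneg ‖x‖])) (hD τ hτ x)
  -- the supremum `M` of `|Γ(s, ·)|`
  have hsI : s ∈ Icc 0 t := ⟨hs, hst.le⟩
  have hbdd : BddAbove (range fun y => |swirl (u s) y|) := ⟨D, by rintro _ ⟨y, rfl⟩; exact hD' s hsI y⟩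
  set M : ℝ := sSup (range fun y => |swirl (u s) y|) with hMdef
  have hMle : ∀ y, |swirl (u s) y| ≤ M := fun y => le_csSup hbdd ⟨y, rfl⟩
  have hMpos : 0 < M := lt_of_lt_of_le (abs_pos.2 hy₀) (hMle y₀)
  -- Step 3: weak maximum principle from time `s` (time translation)
  have hts : 0 < t - s := by linarith
  have hclw : IsClassicalNSSolutionOn (Icc 0 (t - s)) ν 0 (fun τ => u (τ + s)) (fun τ => p (τ + s)) :=
    (hclt.comp_add_right s).mono (fun τ hτ => ⟨by linarith [hτ.1], by linarith [hτ.2]⟩)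
      (uniqueDiffOn_Icc hts)
  have hmemw : ∀ τ ∈ Icc 0 (t - s), τ + s ∈ Icc 0 t := fun τ hτ =>
    ⟨by linarith [hτ.1], by linarith [hτ.2]⟩
  have haxiw : ∀ τ ∈ Icc 0 (t - s), IsAxisymmetric (u (τ + s)) := fun τ hτ => haxit _ (hmemw τ hτ)
  have hVw : ∀ τ ∈ Icc 0 (t - s), ∀ x, ‖u (τ + s) x‖ ≤ V := fun τ hτ x => hV _ (hmemw τ hτ) x
  have hM0w : ∀ x, |swirl (u (0 + s)) x| ≤ M := fun x => by rw [zero_add]; exact hMle x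
  have hweak := abs_swirl_le_of_classical hν hts hclw haxiw hVw hM0w
  -- Step 4: strong maximum principle at unit viscosity
  have hclW := hclw.viscosityRescale_zero hν hts
  have hWslice : ∀ τ' : ℝ,
      timeRescale ν⁻¹ ν⁻¹ (fun τ => u (τ + s)) τ' = ν⁻¹ • u (ν⁻¹ * τ' + s) := fun τ' => rfl
  have hν' : 0 < ν⁻¹ := inv_pos.2 hν
  have hmemW : ∀ τ' ∈ Icc 0 (ν * (t - s)), ν⁻¹ * τ' ∈ Icc 0 (t - s) := fun τ' hτ' =>
    ⟨mul_nonneg hν'.le hτ'.1, by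
      have := mul_le_mul_of_nonneg_left hτ'.2 hν'.le
      rwa [← mul_assoc, inv_mul_cancel₀ hν.ne', one_mul] at this⟩
  have haxiW : ∀ τ' ∈ Icc 0 (ν * (t - s)),
      IsAxisymmetric (timeRescale ν⁻¹ ν⁻¹ (fun τ => u (τ + s)) τ') := fun τ' hτ' => by
    rw [hWslice]; exact isAxisymmetric_const_smul _ (haxiw _ (hmemW τ' hτ'))
  have hVW : ∀ τ' ∈ Icc 0 (ν * (t - s)), ∀ x,
      ‖timeRescale ν⁻¹ ν⁻¹ (fun τ => u (τ + s)) τ' x‖ ≤ ν⁻¹ * V := fun τ' hτ' x => by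
    rw [hWslice, Pi.smul_apply, norm_smul, Real.norm_of_nonneg hν'.le]
    exact mul_le_mul_of_nonneg_left (hVw _ (hmemW τ' hτ') x) hν'.le
  have hMW : ∀ τ' ∈ Icc 0 (ν * (t - s)), ∀ x,
      |swirl (timeRescale ν⁻¹ ν⁻¹ (fun τ => u (τ + s)) τ') x| ≤ ν⁻¹ * M := fun τ' hτ' x => by
    rw [hWslice, swirl_const_smul, abs_mul, abs_of_pos hν']
    exact mul_le_mul_of_nonneg_left (hweak _ (hmemW τ' hτ') x) hν'.le
  have hstrong := abs_swirl_lt_of_classical (mul_pos hν hts) hclW haxiW hVW (mul_pos hν' hMpos) hMW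
  have hlt : ∀ x, |swirl (u t) x| < M := by
    intro x
    have h := hstrong x
    rw [hWslice, swirl_const_smul, abs_mul, abs_of_pos hν'] at h
    have e : ν⁻¹ * (ν * (t - s)) + s = t := by
      rw [← mul_assoc, inv_mul_cancel₀ hν.ne', one_mul]; ring
    rw [e] at h
    exact lt_of_mul_lt_mul_left h hν'.le
  -- Step 5: the supremum of `|Γ(t, ·)|` is attained, hence `< M`
  have htI : t ∈ Icc 0 t := ⟨ht0.le, le_rfl⟩
  by_cases hzero : ∀ x, swirl (u t) x = 0
  · exact ⟨y₀, fun x => by rw [hzero x, abs_zero]; exact abs_pos.2 hy₀⟩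
  · simp only [not_forall] at hzero
    obtain ⟨x₁, hx₁⟩ := hzero
    have hcont : Continuous fun x => |swirl (u t) x| :=
      (contDiff_swirl (hclt.contDiff_velocity htI)).continuous.abs
    obtain ⟨xs, hxs⟩ := exists_forall_le_of_decay hcont (hD t htI) (abs_pos.2 hx₁)
    obtain ⟨_, ⟨y, rfl⟩, hy⟩ := exists_lt_of_lt_csSup (range_nonempty fun y => |swirl (u s) y|) (hlt xs)
    exact ⟨y, fun x => lt_of_le_of_lt (hxs x) hy⟩

end Summit.NavierStokesRegularity.NavierStokesRegularity.Theorems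

end
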